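import Summits.Ventures.PercRepro.RankLevelSetLevelSixHeavy
import Summits.Ventures.PercRepro.RankLevelSetLevelFivePart

/-!
# PercRepro — THEOREM C₆ WITH THE HEAVY / LIGHT COUNT AT RANK `53`: C-025 AT LEVEL `6` FOR EVERY `p ≥ 53` (p8, S3)

`proofs/SUBCLAIM-S3-p8.md` §3f. `c025_six_of_five_heavy` (RankLevelSetLevelSixHeavy: level `5` for every `p ≥ 52`
gives level `6` for every `p ≥ 53`) on p7's partition chain `c025_five_large_part33 (33 ≤ p)`
(RankLevelSetLevelFivePart): **`c025_six_large_fifty_three (53 ≤ p) : RLS M p 6`**, every finite matroid,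
unconditional over the tree. Axioms: standard.
-/

open scoped Matroid

namespace PercRepro

namespace ThmN

open Set

variable {α : Type}

/-- **C-025 AT LEVEL `6` FOR EVERY `p ≥ 53`, EVERY FINITE MATROID, UNCONDITIONAL** — `c025_six_of_five_heavy` on
p7's level-`5` row `c025_five_large_part33 (33 ≤ p)`. -/
theorem c025_six_large_fifty_three (M : Matroid α) [M.Finite] (p : ℕ) (hp : 53 ≤ p) : RLS M p 6 :=
  c025_six_of_five_heavy (fun M _ p hp => c025_five_large_part33 M p (by omega)) M p hp

/-- The same in the vocabulary of `C025`: the level-`6` frontier of the counting route is every `p ≥ 53`. -/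
theorem c025_six_large_fifty_three' (M : Matroid α) [M.Finite] (p : ℕ) (hp : 53 ≤ p) :
    phiK p 6 * ({A : Set α | A ⊆ M.E ∧ M.eRk A = (p : ℕ∞) ∧ M.eRk (M.E \ A) = (6 : ℕ∞)}.ncard : ℚ) ≤
      ({A : Set α | A ⊆ M.E ∧ (6 : ℕ∞) < M.eRk A ∧ M.eRk A < (p : ℕ∞)}.ncard : ℚ) :=
  c025_six_large_fifty_three M p hp

end ThmN

end PercRepro
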